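import Mathlib
import HarnessLib
import Summits.HubbardSuperconductivity.HubbardSuperconductivity.Theorems.KLProgrammeKLRegimeEngineTowerBookkeepingTracks

/-!
# Route `KLProgramme` — crux K3 ENGINE (stmt-HubbardSuperconductivity-20437 `KLRegimeEngineV17F2`), stub (b) v2, THE LEVELS PACKAGE (ℓ):
# the blocked-tower bookkeeping, part 9″ — THE TRACK INDUCTION IN PROFILE FORM (located item «(I2)-F1-HMU», memo HOME/prover-p4/F1-HMU-SQUEEZE.md;
# cell gate-hubbard-kl, seat gate-hubbard-kl-p4 g18)

Part 9′ (`towerBorn_le_law_tracks`, …EngineTowerBookkeepingTracks) reads the re-measurement hypothesis `(Hμ)` in ONE literal two-row shape with k-free constants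
`c₁c₂^m·r^{(a m − bo)(k+1−k′)}` / `c₃c₂^m·r^{(a m − bon)(k+1−k′)}·h^{k′}`.  The located item «(I2)-F1-HMU» (p4 g18) shows that the F = 1 track of the levelled model
cannot be served in that shape from the landed count rows (no admissible choice of the narrow/wide regime parameters for the born blocks `k′ > 5(k+1)/17`), and
every cure under discussion (graded precision tracks, pin-averaged components, a separate six-leg corner object) re-shapes `(Hμ)`.  The induction itself uses `(Hμ)`
only through its CONSEQUENCE — the measured profile `μ k m ≤ A′λ^{m−1}Q′^m` (`4 ≤ m ≤ D`) and the six-leg import `μ k 3 ≤ ι₃λ²` given the law on all earlier blocks.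
This file states the induction with exactly those consequences as hypotheses, so that the model side may use ANY re-measurement scheme:

* **`towerBorn_le_law_tracks_of_profile`** (T3-P) — tracks `t : T`, UV law, imports `ι₁λ`, `ι₂λ`, the PROFILE hypotheses
  `hprof : ∀ k < K, (∀ k′ ≤ k, ∀ t, law for b t k′ ·) → ∀ m ∈ [4, D], μ k m ≤ A′λ^{m−1}Q′^m` and `hprof3 : … → μ k 3 ≤ ι₃λ²`, the step hypothesis for every track,
  the numerics of part 9′ verbatim (`hx₁ hx₂ hx₃ hy hθ hu₁ hu₂ hclose`) ⊢ `∀ k ≤ K, ∀ t, ∀ 3 ≤ p ≤ D, b t k p ≤ Aλ^{p−1}Q^p`.  (Part 9′ is the instance whose profile comes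
  from `towerMeasured_le_profile_split_rate` / `towerMeasured_three_le_split`; its proof is this one with those two rows inlined — not restated here.)
* **`towerMeasured_le_law_mul_of_coeffSum`**, **`towerMeasured_le_profile_of_coeffSum`** — the profile from re-measurement coefficients `w t k k′ m ≥ 0` with ARBITRARY
  `(k, k′)`-dependence: `μ k m ≤ Σ_t Σ_{k′≤k} w t k k′ m·b t k′ m`, the law on the blocks `k′ ≤ k`, and `Σ_{k′≤k} w t k k′ m ≤ α_t·γ_t^m` ⊢
  `μ k m ≤ (Σ_t α_tγ_t^m)·Aλ^{m−1}Q^m ≤ A′λ^{m−1}Q′^m` once `γ_t Q ≤ Q′` and `(Σ_t α_t)·A ≤ A′`.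
Pure real analysis; nothing about the model is asserted; nothing asserts any stub, K3 or superconductivity.
References: Benfatto–Giuliani–Mastropietro 2006 §2.8 (2.83), (2.93)–(2.98) [cite: BenfattoGiulianiMastropietro2006]; Gawȩdzki–Kupiainen 1985 §3.
-/

noncomputable section

namespace Summit.HubbardSuperconductivity.HubbardSuperconductivity.Theorems.EngineV8

set_option linter.dupNamespace false -- summit = problem name (single-conjunct summit), D-0017

open Real Finset

/-! ## §1 The measured profile from re-measurement coefficients with bounded block sums -/

/-- **The measured size against the law, from coefficient sums.**  If `μ k m ≤ Σ_t Σ_{k′ ≤ k} w t k k′ m · b t k′ m` with nonnegative coefficients whose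
block sums are `≤ α_t·γ_t^m`, and every `b t k′ m` (`k′ ≤ k`) obeys `Aλ^{m−1}Q^m`, then `μ k m ≤ (Σ_t α_t γ_t^m)·Aλ^{m−1}Q^m`.  The `(k, k′)`-dependence of `w` is free.
[cite: BenfattoGiulianiMastropietro2006, §2.8 (2.93)-(2.98)] -/
theorem towerMeasured_le_law_mul_of_coeffSum {T : Type*} [Fintype T] {D : ℕ} {b : T → ℕ → ℕ → ℝ} {μ : ℕ → ℕ → ℝ}
    {A lam Q : ℝ} {w : T → ℕ → ℕ → ℕ → ℝ} {α γ : T → ℝ}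
    (hA : 0 ≤ A) (hlam : 0 ≤ lam) (hQ : 0 ≤ Q) (hw0 : ∀ t k k' m, 0 ≤ w t k k' m)
    (hwsum : ∀ t k m, 3 ≤ m → m ≤ D → ∑ k' ∈ range (k + 1), w t k k' m ≤ α t * γ t ^ m)
    {k : ℕ} (hμ : ∀ m, 3 ≤ m → m ≤ D → μ k m ≤ ∑ t, ∑ k' ∈ range (k + 1), w t k k' m * b t k' m)
    (hb : ∀ k' ≤ k, ∀ t, ∀ m, 3 ≤ m → m ≤ D → b t k' m ≤ A * lam ^ (m - 1) * Q ^ m)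
    {m : ℕ} (hm : 3 ≤ m) (hmD : m ≤ D) :
    μ k m ≤ (∑ t, α t * γ t ^ m) * (A * lam ^ (m - 1) * Q ^ m) := by
  have hlaw0 : 0 ≤ A * lam ^ (m - 1) * Q ^ m := by positivity
  refine (hμ m hm hmD).trans ?_
  rw [sum_mul]
  refine sum_le_sum fun t _ => ?_
  calc ∑ k' ∈ range (k + 1), w t k k' m * b t k' m
      ≤ ∑ k' ∈ range (k + 1), w t k k' m * (A * lam ^ (m - 1) * Q ^ m) :=
        sum_le_sum fun k' hk' => mul_le_mul_of_nonneg_left (hb k' (Nat.lt_succ_iff.1 (mem_range.1 hk')) t m hm hmD) (hw0 t k k' m)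
    _ = (∑ k' ∈ range (k + 1), w t k k' m) * (A * lam ^ (m - 1) * Q ^ m) := by rw [sum_mul]
    _ ≤ α t * γ t ^ m * (A * lam ^ (m - 1) * Q ^ m) := mul_le_mul_of_nonneg_right (hwsum t k m hm hmD) hlaw0

/-- **The measured PROFILE from coefficient sums**: under the hypotheses of `towerMeasured_le_law_mul_of_coeffSum` and the fit `γ_t·Q ≤ Q′`, `(Σ_t α_t)·A ≤ A′`
(`α, γ, Q′ ≥ 0`), `μ k m ≤ A′λ^{m−1}Q′^m` — the `hprof` input of `towerBorn_le_law_tracks_of_profile` at block `k`. [cite: BenfattoGiulianiMastropietro2006, §2.8 (2.93)-(2.98)] -/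
theorem towerMeasured_le_profile_of_coeffSum {T : Type*} [Fintype T] {D : ℕ} {b : T → ℕ → ℕ → ℝ} {μ : ℕ → ℕ → ℝ}
    {A lam Q A' Q' : ℝ} {w : T → ℕ → ℕ → ℕ → ℝ} {α γ : T → ℝ}
    (hA : 0 ≤ A) (hlam : 0 ≤ lam) (hQ : 0 ≤ Q) (hQ'0 : 0 ≤ Q') (hα : ∀ t, 0 ≤ α t) (hγ : ∀ t, 0 ≤ γ t) (hw0 : ∀ t k k' m, 0 ≤ w t k k' m)
    (hwsum : ∀ t k m, 3 ≤ m → m ≤ D → ∑ k' ∈ range (k + 1), w t k k' m ≤ α t * γ t ^ m)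
    (hQ' : ∀ t, γ t * Q ≤ Q') (hA' : (∑ t, α t) * A ≤ A')
    {k : ℕ} (hμ : ∀ m, 3 ≤ m → m ≤ D → μ k m ≤ ∑ t, ∑ k' ∈ range (k + 1), w t k k' m * b t k' m)
    (hb : ∀ k' ≤ k, ∀ t, ∀ m, 3 ≤ m → m ≤ D → b t k' m ≤ A * lam ^ (m - 1) * Q ^ m)
    {m : ℕ} (hm : 3 ≤ m) (hmD : m ≤ D) :
    μ k m ≤ A' * lam ^ (m - 1) * Q' ^ m := by
  have h1 := towerMeasured_le_law_mul_of_coeffSum (D := D) hA hlam hQ hw0 hwsum hμ hb hm hmD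
  refine h1.trans ?_
  calc (∑ t, α t * γ t ^ m) * (A * lam ^ (m - 1) * Q ^ m)
      = ∑ t, α t * A * lam ^ (m - 1) * (γ t * Q) ^ m := by rw [sum_mul]; refine sum_congr rfl fun t _ => ?_; rw [mul_pow]; ring
    _ ≤ ∑ t, α t * A * lam ^ (m - 1) * Q' ^ m :=
        sum_le_sum fun t _ => mul_le_mul_of_nonneg_left (pow_le_pow_left₀ (mul_nonneg (hγ t) hQ) (hQ' t) m)
          (by have := hα t; positivity)
    _ = (∑ t, α t) * A * lam ^ (m - 1) * Q' ^ m := by rw [sum_mul, sum_mul, sum_mul]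
    _ ≤ A' * lam ^ (m - 1) * Q' ^ m := by
        have : 0 ≤ lam ^ (m - 1) * Q' ^ m := by positivity
        nlinarith [hA', this]

/-! ## §2 (T3-P) The track induction in profile form -/

/-- **(T3-P) The blocked birth-level tower with finitely many tracks, PROFILE FORM.**  As `towerBorn_le_law_tracks` (part 9′), but the re-measurement enters only
through its consequences: for every block `k < K`, GIVEN the law `b t k′ p ≤ Aλ^{p−1}Q^p` on all tracks and all `k′ ≤ k`, the measured profile
`μ k m ≤ A′λ^{m−1}Q′^m` (`4 ≤ m ≤ D`) and the six-leg import `μ k 3 ≤ ι₃λ²`.  With the UV law, the imports `ι₁λ`, `ι₂λ`, the step hypothesis for every track and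
part 9′'s numerics verbatim, every track obeys the law at every boundary.  Any re-measurement scheme (split rows with block-dependent regime parameters, graded or
averaged tracks, coefficient sums via `towerMeasured_le_profile_of_coeffSum`) that delivers these two profile rows feeds this theorem unchanged.
[cite: BenfattoGiulianiMastropietro2006, §2.8 (2.83), (2.93)-(2.98)] -/
theorem towerBorn_le_law_tracks_of_profile {T : Type*} {D K : ℕ} {b : T → ℕ → ℕ → ℝ} {μ : ℕ → ℕ → ℝ}
    {A lam Q σ Φ ψ τ A' Q' ι₁ ι₂ ι₃ : ℝ}
    (hlam : 0 < lam) (hQ : 0 ≤ Q)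
    (hσ : 0 ≤ σ) (hΦ : 0 ≤ Φ) (hψ : 0 ≤ ψ) (hτ : 0 < τ) (hQ'0 : 0 < Q') (hA'0 : 0 ≤ A')
    (hμ0 : ∀ k m, 0 ≤ μ k m)
    (h0 : ∀ t p, 3 ≤ p → p ≤ D → b t 0 p ≤ A * lam ^ (p - 1) * Q ^ p)
    (hprof : ∀ k < K, (∀ k' ≤ k, ∀ t, ∀ p, 3 ≤ p → p ≤ D → b t k' p ≤ A * lam ^ (p - 1) * Q ^ p) →
      ∀ m, 4 ≤ m → m ≤ D → μ k m ≤ A' * lam ^ (m - 1) * Q' ^ m)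
    (hprof3 : ∀ k < K, 3 ≤ D → (∀ k' ≤ k, ∀ t, ∀ p, 3 ≤ p → p ≤ D → b t k' p ≤ A * lam ^ (p - 1) * Q ^ p) →
      μ k 3 ≤ ι₃ * lam ^ 2)
    (hι₁ : ∀ k < K, μ k 1 ≤ ι₁ * lam) (hι₂ : ∀ k < K, μ k 2 ≤ ι₂ * lam)
    (hstep : ∀ t, ∀ k < K, ∀ N : ℕ, 2 ≤ N → ∀ p, 3 ≤ p → p ≤ D → Φ * towerV D τ (μ k) < 1 →
      b t (k + 1) p ≤ towerFO D σ (μ k) p + ∑ n ∈ Icc 2 N, exp 1 * Φ ^ (n - 1) * ψ ^ p * towerS D τ (μ k) n p +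
        ψ ^ p * exp 1 * towerV D τ (μ k) * (Φ * towerV D τ (μ k)) ^ N / (1 - Φ * towerV D τ (μ k)))
    (hx₁ : 4 * σ * lam * Q' < 1) (hx₂ : 2 * lam * τ * Q' ≤ 1) (hx₃ : exp 1 * τ * lam * Q' < 1)
    (hy : Φ * (τ * (ι₁ * lam + ι₂ / (2 * Q') + ι₃ / (4 * Q' ^ 2) + A' * Q' / 4)) < 1)
    (hθ : Φ * (exp 1 * τ * (ι₁ * lam) + (exp 1 * τ) ^ 2 * (ι₂ * lam) + (exp 1 * τ) ^ 3 * (ι₃ * lam ^ 2) +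
      A' * (exp 1 * τ * Q') * ((exp 1 * τ * lam * Q') ^ 3 / (1 - exp 1 * τ * lam * Q'))) < 1)
    (hu₁ : 4 * Q' ≤ Q) (hu₂ : 2 * τ * ψ * Q' ≤ Q)
    (hclose : A' * (4 * Q') ^ 3 * (4 * σ * lam * Q' / (1 - 4 * σ * lam * Q')) +
      exp 1 * ψ * (2 * τ * ψ * Q') ^ 2 * (τ * (ι₁ * lam + ι₂ / (2 * Q') + ι₃ / (4 * Q' ^ 2) + A' * Q' / 4)) *
        (Φ * (τ * (ι₁ * lam + ι₂ / (2 * Q') + ι₃ / (4 * Q' ^ 2) + A' * Q' / 4)) /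
          (1 - Φ * (τ * (ι₁ * lam + ι₂ / (2 * Q') + ι₃ / (4 * Q' ^ 2) + A' * Q' / 4)))) ≤ A * Q ^ 3) :
    ∀ k ≤ K, ∀ t, ∀ p, 3 ≤ p → p ≤ D → b t k p ≤ A * lam ^ (p - 1) * Q ^ p := by
  have hx10 : 0 ≤ 4 * σ * lam * Q' / (1 - 4 * σ * lam * Q') := div_nonneg (by positivity) (sub_nonneg.2 hx₁.le)
  have hw : 1 ≤ (2 * τ * Q' * lam)⁻¹ := (one_le_inv₀ (by positivity)).2 (by linarith)
  set Y := ι₁ * lam + ι₂ / (2 * Q') + ι₃ / (4 * Q' ^ 2) + A' * Q' / 4 with hY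
  suffices H : ∀ k ≤ K, ∀ k' ≤ k, ∀ t, ∀ p, 3 ≤ p → p ≤ D → b t k' p ≤ A * lam ^ (p - 1) * Q ^ p from
    fun k hk t p hp hpD => H k hk k le_rfl t p hp hpD
  intro k
  induction k with
  | zero => intro _ k' hk' t p hp hpD; rw [Nat.le_zero.1 hk']; exact h0 t p hp hpD
  | succ k ih =>
    intro hk1 k' hk' t p hp hpD
    have hkK : k < K := Nat.lt_of_succ_le hk1
    have ih' := ih (Nat.le_of_succ_le hk1)
    rcases Nat.lt_succ_iff_lt_or_eq.1 (Nat.lt_succ_of_le hk') with hlt | rfl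
    · exact ih' k' (Nat.lt_succ_iff.1 hlt) t p hp hpD
    · have hD3 : 3 ≤ D := hp.trans hpD
      -- the measured profile and the six-leg import at block `k`, from the law on all earlier blocks
      have hIH : ∀ k'' ≤ k, ∀ t, ∀ p, 3 ≤ p → p ≤ D → b t k'' p ≤ A * lam ^ (p - 1) * Q ^ p :=
        fun k'' hk'' t p hp hpD => ih' k'' hk'' t p hp hpD
      have hprof' : ∀ m, 4 ≤ m → m ≤ D → μ k m ≤ A' * lam ^ (m - 1) * Q' ^ m := hprof k hkK hIH
      have hμ3' : μ k 3 ≤ ι₃ * lam ^ 2 := hprof3 k hkK hD3 hIH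
      -- Chernoff data
      have hG := sum_fourPiece_le (D := D) hτ hlam hQ'0 hA'0 (hμ0 k) (hι₁ k hkK) (hι₂ k hkK) hμ3' hprof'
      have hG0 : 0 ≤ τ * Y := (sum_nonneg fun δ _ => by have := hμ0 k δ; positivity).trans hG
      have hY0' : 0 ≤ Y := (mul_nonneg_iff_of_pos_left hτ).1 hG0
      have hVb := towerV_le_fourPiece hτ.le hlam.le hQ'0.le hA'0 (hμ0 k) (hι₁ k hkK) (hι₂ k hkK) hμ3' hprof' hx₃
      -- the closing computation, for any born size obeying the step hypothesis with these Chernoff data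
      have hclose' : ∀ x : ℝ, (∀ N : ℕ, 2 ≤ N → Φ * towerV D τ (μ k) < 1 →
          x ≤ towerFO D σ (μ k) (3 + (p - 3)) + ∑ n ∈ Icc 2 N, exp 1 * Φ ^ (n - 1) * ψ ^ (3 + (p - 3)) * towerS D τ (μ k) n (3 + (p - 3)) +
            ψ ^ (3 + (p - 3)) * exp 1 * towerV D τ (μ k) * (Φ * towerV D τ (μ k)) ^ N / (1 - Φ * towerV D τ (μ k))) →
          x ≤ A * lam ^ (3 + (p - 3) - 1) * Q ^ (3 + (p - 3)) := by
        intro x hx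
        have hT2 := towerStep_le_of_chernoff (D := D) hΦ hψ hτ.le (hμ0 k) hw
          (towerFO_le_of_four_le hσ hA'0 hlam.le hQ'0.le (hμ0 k) hprof' hx₁ (p := 3 + (p - 3)) (by omega) (D := D)) hG hVb hy hθ hx
        refine hT2.trans ?_
        have hinv : (((2 * τ * Q' * lam)⁻¹) ^ (3 + (p - 3) - 1))⁻¹ = (2 * τ * Q' * lam) ^ (3 + (p - 3) - 1) := by rw [inv_pow, inv_inv]
        rw [hinv]
        have hyq0 : 0 ≤ Φ * (τ * Y) / (1 - Φ * (τ * Y)) := div_nonneg (by positivity) (sub_nonneg.2 hy.le)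
        set rr := p - 3 with hrr
        have h4 : (4 * Q') ^ (3 + rr) ≤ (4 * Q') ^ 3 * Q ^ rr := by
          rw [pow_add]; exact mul_le_mul_of_nonneg_left (pow_le_pow_left₀ (by positivity) hu₁ rr) (by positivity)
        have h2 : ψ ^ (3 + rr) * (2 * τ * Q' * lam) ^ (3 + rr - 1) ≤ lam ^ (3 + rr - 1) * ψ * ((2 * τ * ψ * Q') ^ 2 * Q ^ rr) := by
          have heq : ψ ^ (3 + rr) * (2 * τ * Q' * lam) ^ (3 + rr - 1) = lam ^ (3 + rr - 1) * ψ * ((2 * τ * ψ * Q') ^ 2 * (2 * τ * ψ * Q') ^ rr) := by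
            rw [show 3 + rr - 1 = rr + 2 by omega, show 3 + rr = rr + 2 + 1 by omega]
            ring
          rw [heq]
          have hr' : (2 * τ * ψ * Q') ^ rr ≤ Q ^ rr := pow_le_pow_left₀ (by positivity) hu₂ rr
          exact mul_le_mul_of_nonneg_left (mul_le_mul_of_nonneg_left hr' (by positivity)) (by positivity)
        set X₁ := 4 * σ * lam * Q' / (1 - 4 * σ * lam * Q') with hX₁
        set Z := Φ * (τ * Y) / (1 - Φ * (τ * Y)) with hZ
        calc A' * lam ^ (3 + rr - 1) * (4 * Q') ^ (3 + rr) * X₁ + exp 1 * ψ ^ (3 + rr) * (2 * τ * Q' * lam) ^ (3 + rr - 1) * (τ * Y) * Z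
            ≤ A' * lam ^ (3 + rr - 1) * ((4 * Q') ^ 3 * Q ^ rr) * X₁ +
                exp 1 * (lam ^ (3 + rr - 1) * ψ * ((2 * τ * ψ * Q') ^ 2 * Q ^ rr)) * (τ * Y) * Z := by
              have : exp 1 * ψ ^ (3 + rr) * (2 * τ * Q' * lam) ^ (3 + rr - 1) = exp 1 * (ψ ^ (3 + rr) * (2 * τ * Q' * lam) ^ (3 + rr - 1)) := by
                ring
              rw [this]
              gcongr
          _ = lam ^ (3 + rr - 1) * Q ^ rr * (A' * (4 * Q') ^ 3 * X₁ + exp 1 * ψ * (2 * τ * ψ * Q') ^ 2 * (τ * Y) * Z) := by ring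
          _ ≤ lam ^ (3 + rr - 1) * Q ^ rr * (A * Q ^ 3) := mul_le_mul_of_nonneg_left hclose (by positivity)
          _ = A * lam ^ (3 + rr - 1) * Q ^ (3 + rr) := by rw [pow_add]; ring
      have hp3 : p = 3 + (p - 3) := by omega
      have hfin := hclose' (b t (k + 1) p) (fun N hN hguard => by rw [← hp3]; exact hstep t k hkK N hN p hp hpD hguard)
      rwa [← hp3] at hfin

end Summit.HubbardSuperconductivity.HubbardSuperconductivity.Theorems.EngineV8

end
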